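import Literature.NumberTheory.Transcendental.GaGmSubgroups
import Mathlib.LinearAlgebra.Dual.Lemmas
import Mathlib.LinearAlgebra.FreeModule.PID
import Mathlib.Algebra.Polynomial.Roots
import HarnessLib

/-!
# The degree clause of Philippon's zero estimate on `𝔾ₐ × 𝔾ₘⁿ` (conclusion (iii) of
`Philippon1986_GaGm_P1n`)

Topic `Literature/NumberTheory/Transcendental`. Input for the discharge of the named fact
`Philippon1986_GaGm_P1n` (`PhilipponZeroEstimateP1n.lean`, Philippon 1986 Thm 2.1 at `T = 0` on
`G = 𝔾ₐ × 𝔾ₘⁿ ⊂ (ℙ¹)ⁿ⁺¹`), built on the toolkit `GaGmZariski` / `GaGmBezout` / `GaGmSubgroups`.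
Everything here is PROVED; no named facts.

Philippon's conclusion "`G'` est incomplètement défini dans `G` par des équations de multidegrés
`≤ (c₁D₁, …, c_pD_p)`" (Déf. 3.5, p. 371: `G'` is an irreducible component of `G ∩ 𝒵(I)` for an
ideal `I` generated by forms of those multidegrees) is read in `Philippon1986_GaGm_P1n` (iii) as:
the character lattice `A` of `G' = V × T_A` is rationally spanned by its elements `λ` with
`max_h |λ_h| ≤ D₁`. This file proves exactly that reading, for the objects the descent produces:

* `GaGm.exists_box_chars_of_mem_comps`: if an irreducible closed subgroup `H₀ ≤ G(ℂ)` is (the set of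
  points of) a component `Z(𝔮)`, `𝔮 ∈ comps Z(F)`, of the zero set of a family `F ⊆ Box(D₀, D₁; 1)`
  of box polynomials, then every character `χ ∈ charGroup H₀` has a non-zero multiple in the group
  generated by the finitely many `λ ∈ charGroup H₀` with `|λ_h| ≤ D₁` for all `h`.

Proof (elementary; the module docstring of `PhilipponZeroEstimateP1n.lean` sketches the variant
through the overgroup `V × T_{A'}`; here we avoid the irreducibility of that overgroup by a curve
argument). Let `Λ = {λ ∈ A ; |λ_h| ≤ D₁}` and suppose `χ₀ ∈ A` has no non-zero multiple in `⟨Λ⟩`.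
(1) Integer duality (`DegreeClause.exists_int_functional`): the saturation `p` of `⟨Λ⟩` in `ℤⁿ` is
a direct summand (`ℤⁿ/p` is torsion-free, hence free), so some `w ∈ ℤⁿ = Hom(ℤⁿ, ℤ)` kills `Λ`
with `⟨χ₀, w⟩ ≠ 0`. (2) Along the one-parameter subgroup `c(s) = (s^{w₁}, …, s^{w_n})` every
`f ∈ F` vanishes on `K = H₀ · c(ℂˣ)` (`DegreeClause.evalAt_mul_curve_eq_zero`): group the monomials
of `f` by (`X`-exponent, character of `H₀`); the class sums vanish because `f|_{H₀} = 0` (Artin's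
independence of characters, `linearIndependent_monoidHom`, after clearing the `𝔾ₐ`-variable by
`Polynomial.eq_zero_of_infinite_isRoot`), and inside a class both the value on `H₀` and the weight
`⟨e, w⟩` are constant — two exponents in one class differ by an element of `A` with entries in
`[-D₁, D₁]`, i.e. by an element of `Λ ⊆ ker w`. (3) `𝔍(K)` is prime
(`DegreeClause.isPrime_vanishing_curveSet`: for fixed `k ∈ H₀` the function `s ↦ P(k·c(s))` is a
Laurent polynomial, so `{s ; P(·c(s)) ∈ 𝔍(H₀)}` is cofinite-or-finite, and `ℂˣ` is infinite), so
the closure of `K` is an irreducible closed subset of `Z(F)` strictly containing the component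
`H₀` (`c(2) ∉ H₀` as `2^{⟨χ₀,w⟩} ≠ 1`) — contradiction.

## References

* P. Philippon, *Lemmes de zéros dans les groupes algébriques commutatifs*, Bull. Soc. Math.
  France 114 (1986), 355–383, Déf. 3.5 (p. 371), Thm 2.1 (p. 358), §5 (p. 381: `J` and `G_V⁰`).
  [Philippon1986]
* Yu. V. Nesterenko, P. Philippon (eds.), LNM 1752 (2001), Ch. 11 (D. Roy), §4.
  [NesterenkoPhilippon2001]
-/

noncomputable section

open MvPolynomial
open scoped Pointwise

namespace Literature.NumberTheory.Transcendental

namespace GaGm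

variable {n : ℕ}

namespace DegreeClause

/-! ### Integer duality -/

/-- The saturation of a subgroup of `ℤⁿ`, as a `ℤ`-submodule. [folklore] -/
def satur (L : AddSubgroup (Fin n → ℤ)) : Submodule ℤ (Fin n → ℤ) where
  carrier := {v | ∃ k : ℤ, k ≠ 0 ∧ k • v ∈ L}
  zero_mem' := ⟨1, one_ne_zero, by simp⟩
  add_mem' := by
    rintro v v' ⟨k, hk, hv⟩ ⟨k', hk', hv'⟩
    refine ⟨k * k', mul_ne_zero hk hk', ?_⟩
    have e : (k * k') • (v + v') = k' • (k • v) + k • (k' • v') := by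
      rw [smul_add, mul_smul, mul_smul, smul_comm k k' v]
    rw [e]
    exact L.add_mem (L.zsmul_mem hv _) (L.zsmul_mem hv' _)
  smul_mem' := by
    rintro c v ⟨k, hk, hv⟩
    refine ⟨k, hk, ?_⟩
    rw [smul_comm]
    exact L.zsmul_mem hv _

/-- Membership in the saturation. [folklore] -/
theorem mem_satur_iff {L : AddSubgroup (Fin n → ℤ)} {v : Fin n → ℤ} :
    v ∈ satur L ↔ ∃ k : ℤ, k ≠ 0 ∧ k • v ∈ L := Iff.rfl

/-- The quotient by a saturated subgroup is torsion-free. [folklore] -/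
instance isTorsionFree_quotient_satur (L : AddSubgroup (Fin n → ℤ)) :
    Module.IsTorsionFree ℤ ((Fin n → ℤ) ⧸ satur L) := by
  refine Module.IsTorsionFree.of_smul_eq_zero fun c x h => ?_
  induction x using Submodule.Quotient.induction_on with
  | H v =>
    by_cases hc : c = 0
    · exact Or.inl hc
    · right
      change (Submodule.Quotient.mk (c • v) : (Fin n → ℤ) ⧸ satur L) = 0 at h
      rw [Submodule.Quotient.mk_eq_zero, mem_satur_iff] at h
      obtain ⟨k, hk, hkv⟩ := h
      rw [Submodule.Quotient.mk_eq_zero, mem_satur_iff]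
      exact ⟨k * c, mul_ne_zero hk hc, by rwa [mul_smul]⟩

/-- **Integer duality.** If no non-zero multiple of `χ₀ ∈ ℤⁿ` lies in the subgroup generated by
`Λ`, some integer functional `w` kills `Λ` but not `χ₀` (the saturation of `⟨Λ⟩` is a direct
summand of `ℤⁿ`). [folklore] -/
theorem exists_int_functional (Λ : Set (Fin n → ℤ)) (χ₀ : Fin n → ℤ)
    (h : ∀ k : ℤ, k ≠ 0 → k • χ₀ ∉ AddSubgroup.closure Λ) :
    ∃ w : Fin n → ℤ, (∀ lam ∈ Λ, ∑ j, lam j * w j = 0) ∧ ∑ j, χ₀ j * w j ≠ 0 := by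
  classical
  set p := satur (AddSubgroup.closure Λ) with hp
  have hχ₀ : χ₀ ∉ p := by
    rintro ⟨k, hk, hkχ⟩
    exact h k hk hkχ
  haveI : Module.Finite ℤ ((Fin n → ℤ) ⧸ p) := Module.Finite.quotient ℤ p
  haveI : Module.Free ℤ ((Fin n → ℤ) ⧸ p) := Module.free_of_finite_type_torsion_free'
  haveI hP : Module.Projective ℤ ((Fin n → ℤ) ⧸ p) := Module.Projective.of_free
  obtain ⟨f, hf0, hfp⟩ := Submodule.exists_dual_map_eq_bot_of_notMem hχ₀ hP
  refine ⟨fun i => f (fun j => if i = j then 1 else 0), fun lam hlam => ?_, ?_⟩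
  · have hmem : lam ∈ p := ⟨1, one_ne_zero, by simpa using AddSubgroup.subset_closure hlam⟩
    have h0 : f lam = 0 := by
      have : f lam ∈ p.map f := Submodule.mem_map_of_mem hmem
      rwa [hfp, Submodule.mem_bot] at this
    rw [LinearMap.pi_apply_eq_sum_univ f lam] at h0
    simpa [smul_eq_mul] using h0
  · rw [LinearMap.pi_apply_eq_sum_univ f χ₀] at hf0
    simpa [smul_eq_mul] using hf0

/-! ### Monomial values along a one-parameter subgroup of the torus -/

/-- `charVal` is multiplicative in the torus point. [folklore] -/
theorem charVal_mul (y y' : Fin n → ℂˣ) (s : Fin (n + 1) →₀ ℕ) :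
    charVal (y * y') s = charVal y s * charVal y' s := by
  simp only [charVal, Pi.mul_apply, Units.val_mul, mul_pow, Finset.prod_mul_distrib]

/-- The weight `⟨e', w⟩ = ∑ⱼ w_j e_{j+1}` of an exponent along the integer vector `w`. [folklore] -/
def wt (w : Fin n → ℤ) (e : Fin (n + 1) →₀ ℕ) : ℤ := ∑ j, w j * (e j.succ : ℤ)

/-- The value of the monomial `Y^{e'}` at the point `c(s) = (s^{w_j})_j` is `s^{⟨e', w⟩}`. [folklore] -/
theorem charVal_curve (w : Fin n → ℤ) (s : ℂˣ) (e : Fin (n + 1) →₀ ℕ) :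
    charVal (fun j => s ^ w j) e = ((s ^ wt w e : ℂˣ) : ℂ) := by
  have hz : ∀ (t : Finset (Fin n)) (f : Fin n → ℤ), ∏ j ∈ t, s ^ f j = s ^ ∑ j ∈ t, f j := by
    intro t f
    induction t using Finset.induction_on with
    | empty => simp
    | insert i t hi ih => rw [Finset.prod_insert hi, Finset.sum_insert hi, ih, zpow_add]
  rw [charVal_eq_coe, wt, ← hz]
  congr 1
  refine Finset.prod_congr rfl fun j _ => ?_
  rw [← zpow_natCast, ← zpow_mul]

/-- The torus point `c(s) = (s^{w_j})_j` as an element of `G(ℂ)`. [folklore] -/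
def curvePt (w : Fin n → ℤ) (s : ℂˣ) : GaGm n := ((1 : Multiplicative ℂ), fun j => s ^ w j)

/-- `c(s)` has trivial additive coordinate. [folklore] -/
@[simp] theorem curvePt_fst (w : Fin n → ℤ) (s : ℂˣ) : (curvePt w s).1 = 1 := rfl

/-- The torus coordinates of `c(s)`. [folklore] -/
@[simp] theorem curvePt_snd (w : Fin n → ℤ) (s : ℂˣ) : (curvePt w s).2 = fun j => s ^ w j := rfl

/-- **Expansion along the curve**: `P(k · c(s)) = ∑ₑ cₑ x_k^{e₀} y_k^{e'} s^{⟨e', w⟩}`. [folklore] -/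
theorem evalAt_mul_curvePt (w : Fin n → ℤ) (P : MvPolynomial (Fin (n + 1)) ℂ) (k : GaGm n) (s : ℂˣ) :
    evalAt P (k * curvePt w s) = ∑ e ∈ P.support,
      P.coeff e * ((Multiplicative.toAdd k.1) ^ e 0 * (charVal k.2 e * ((s ^ wt w e : ℂˣ) : ℂ))) := by
  rw [evalAt_eq_sum]
  refine Finset.sum_congr rfl fun e _ => ?_
  rw [Prod.fst_mul, curvePt_fst, mul_one, Prod.snd_mul, curvePt_snd, charVal_mul, charVal_curve]

/-- The expansion as a genuine polynomial in `s`: with `M = ∑ₑ |⟨e', w⟩|`,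
`s^M · P(k · c(s))` is the value at `s` of a polynomial. [folklore] -/
theorem exists_polynomial_curve (w : Fin n → ℤ) (P : MvPolynomial (Fin (n + 1)) ℂ) (k : GaGm n) :
    ∃ (q : Polynomial ℂ) (M : ℕ), ∀ s : ℂˣ,
      q.eval (s : ℂ) = (s : ℂ) ^ M * evalAt P (k * curvePt w s) ∧
      (q = 0 → ∀ s : ℂˣ, evalAt P (k * curvePt w s) = 0) := by
  classical
  set M : ℕ := ∑ e ∈ P.support, (wt w e).natAbs with hM
  have hMe : ∀ e ∈ P.support, 0 ≤ wt w e + M := by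
    intro e he
    have h1 : (wt w e).natAbs ≤ M :=
      hM ▸ Finset.single_le_sum (f := fun e => (wt w e).natAbs) (fun _ _ => Nat.zero_le _) he
    omega
  set q : Polynomial ℂ := ∑ e ∈ P.support,
    Polynomial.C (P.coeff e * ((Multiplicative.toAdd k.1) ^ e 0 * charVal k.2 e)) *
      Polynomial.X ^ (wt w e + M).toNat with hq
  have hev : ∀ s : ℂˣ, q.eval (s : ℂ) = (s : ℂ) ^ M * evalAt P (k * curvePt w s) := by
    intro s
    rw [hq, Polynomial.eval_finsetSum, evalAt_mul_curvePt, Finset.mul_sum]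
    refine Finset.sum_congr rfl fun e he => ?_
    rw [Polynomial.eval_mul, Polynomial.eval_C, Polynomial.eval_pow, Polynomial.eval_X]
    have hs0 : (s : ℂ) ≠ 0 := s.ne_zero
    have e1 : (s : ℂ) ^ (wt w e + ↑M).toNat = (s : ℂ) ^ M * ((s ^ wt w e : ℂˣ) : ℂ) := by
      rw [← zpow_natCast, Int.toNat_of_nonneg (hMe e he), Units.val_zpow_eq_zpow_val,
        zpow_add₀ hs0, zpow_natCast, mul_comm]
    rw [e1]; ring
  refine ⟨q, M, fun s => ⟨hev s, fun hq0 s' => ?_⟩⟩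
  have h := hev s'
  rw [hq0, Polynomial.eval_zero] at h
  have hs0 : (s' : ℂ) ^ M ≠ 0 := pow_ne_zero _ s'.ne_zero
  exact (mul_eq_zero.mp h.symm).resolve_left hs0

/-- `ℂˣ` is infinite. [folklore] -/
instance infinite_units_complex : Infinite ℂˣ := by
  refine Infinite.of_injective (fun k : ℕ => Units.mk0 ((k : ℂ) + 1) (by exact_mod_cast Nat.succ_ne_zero k)) ?_
  intro a b h
  have := congrArg (fun u : ℂˣ => (u : ℂ)) h
  simp only [Units.val_mk0, add_left_inj, Nat.cast_inj] at this
  exact this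

/-- For fixed `P` and `k`, the set of parameters `s` with `P(k · c(s)) = 0` is either everything
or finite. [folklore] -/
theorem curve_zeros_finite_or_all (w : Fin n → ℤ) (P : MvPolynomial (Fin (n + 1)) ℂ) (k : GaGm n) :
    (∀ s : ℂˣ, evalAt P (k * curvePt w s) = 0) ∨ {s : ℂˣ | evalAt P (k * curvePt w s) = 0}.Finite := by
  classical
  obtain ⟨q, M, hq⟩ := exists_polynomial_curve w P k
  by_cases hq0 : q = 0
  · exact Or.inl ((hq 1).2 hq0)
  · right
    have hfin : ((fun s : ℂˣ => (s : ℂ)) ⁻¹' (↑q.roots.toFinset : Set ℂ)).Finite :=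
      (q.roots.toFinset.finite_toSet).preimage (Units.val_injective.injOn)
    refine hfin.subset fun s hs => ?_
    simp only [Set.mem_preimage, Finset.mem_coe, Multiset.mem_toFinset, Polynomial.mem_roots hq0,
      Polynomial.IsRoot.def]
    rw [(hq s).1, Set.mem_setOf_eq.mp hs, mul_zero]

/-- The set `K = H₀ · c(ℂˣ)` swept out by an (abstract) subset `H₀` along the curve. [folklore] -/
def curveSet (w : Fin n → ℤ) (H₀ : Set (GaGm n)) : Set (GaGm n) :=
  {g | ∃ k ∈ H₀, ∃ s : ℂˣ, k * curvePt w s = g}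

/-- `c(1) = e`. [folklore] -/
@[simp] theorem curvePt_one (w : Fin n → ℤ) : curvePt w (1 : ℂˣ) = 1 := by
  ext j <;> simp [curvePt]

/-- **`𝔍(H₀ · c(ℂˣ))` is prime** when `𝔍(H₀)` is prime and `H₀ ≠ ∅`: for each `s` one of
`P(· c(s)), Q(· c(s))` lies in `𝔍(H₀)`, and for fixed `k` the zeros in `s` of `P(k · c(s))` are
cofinite-or-finite. [folklore] -/
theorem isPrime_vanishing_curveSet (w : Fin n → ℤ) {H₀ : Set (GaGm n)} (hne : H₀.Nonempty)
    (hprime : (vanishing H₀).IsPrime) : (vanishing (curveSet w H₀)).IsPrime := by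
  classical
  have hKne : (curveSet w H₀).Nonempty := by
    obtain ⟨k, hk⟩ := hne
    exact ⟨k * curvePt w 1, k, hk, 1, rfl⟩
  refine ⟨vanishing_ne_top hKne, fun {P Q} hPQ => ?_⟩
  -- membership of a shifted polynomial in `𝔍(H₀)`
  have hshift : ∀ (R : MvPolynomial (Fin (n + 1)) ℂ) (s : ℂˣ),
      shift (curvePt w s) R ∈ vanishing H₀ ↔ ∀ k ∈ H₀, evalAt R (k * curvePt w s) = 0 := by
    intro R s
    simp only [mem_vanishing_iff, evalAt_shift, mul_comm (curvePt w s)]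
  -- for each `s`, one of the shifted factors lies in the prime `𝔍(H₀)`
  have hs : ∀ s : ℂˣ, shift (curvePt w s) P ∈ vanishing H₀ ∨ shift (curvePt w s) Q ∈ vanishing H₀ := by
    intro s
    refine hprime.mem_or_mem ?_
    rw [← map_mul, hshift]
    intro k hk
    exact hPQ (k * curvePt w s) ⟨k, hk, s, rfl⟩
  by_contra hcon
  rw [not_or] at hcon
  obtain ⟨hP, hQ⟩ := hcon
  have hP' : ∃ k₁ ∈ H₀, ¬ ∀ s : ℂˣ, evalAt P (k₁ * curvePt w s) = 0 := by
    by_contra h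
    push Not at h
    exact hP fun g ⟨k, hk, s, hg⟩ => by rw [← hg]; exact h k hk s
  have hQ' : ∃ k₂ ∈ H₀, ¬ ∀ s : ℂˣ, evalAt Q (k₂ * curvePt w s) = 0 := by
    by_contra h
    push Not at h
    exact hQ fun g ⟨k, hk, s, hg⟩ => by rw [← hg]; exact h k hk s
  obtain ⟨k₁, hk₁, hk₁P⟩ := hP'
  obtain ⟨k₂, hk₂, hk₂Q⟩ := hQ'
  have hfinP : {s : ℂˣ | evalAt P (k₁ * curvePt w s) = 0}.Finite :=
    (curve_zeros_finite_or_all w P k₁).resolve_left hk₁P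
  have hfinQ : {s : ℂˣ | evalAt Q (k₂ * curvePt w s) = 0}.Finite :=
    (curve_zeros_finite_or_all w Q k₂).resolve_left hk₂Q
  have hcover : (Set.univ : Set ℂˣ) ⊆
      {s : ℂˣ | evalAt P (k₁ * curvePt w s) = 0} ∪ {s : ℂˣ | evalAt Q (k₂ * curvePt w s) = 0} := by
    intro s _
    rcases hs s with h | h
    · exact Or.inl ((hshift P s).mp h k₁ hk₁)
    · exact Or.inr ((hshift Q s).mp h k₂ hk₂)
  exact Set.infinite_univ ((hfinP.union hfinQ).subset hcover)

/-! ### Box polynomials vanishing on an irreducible closed subgroup vanish along the curve -/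

/-- Membership in an irreducible closed subgroup `H₀ = V × T_A`: through `addPart` and the
characters `charGroup H₀` (the structure theorem `toSubgroup_toConnAlgSubgroup`). [folklore] -/
theorem mem_iff_of_isIrred (H₀ : Subgroup (GaGm n)) (hirr : IsIrred (H₀ : Set (GaGm n))) (g : GaGm n) :
    g ∈ H₀ ↔ ((toConnAlgSubgroup H₀ hirr).addPart = false → g.1 = 1) ∧
      ∀ χ ∈ charGroup (H₀ : Set (GaGm n)), ∏ j, (g.2 j) ^ (χ j) = 1 := by
  conv_lhs => rw [← toSubgroup_toConnAlgSubgroup H₀ hirr]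
  rfl

/-- **Key lemma.** Let `H₀` be an irreducible closed subgroup, `f ∈ Box(D₀, D₁; 1)` a box
polynomial vanishing on `H₀`, and `w ∈ ℤⁿ` an integer vector orthogonal to every character of
`H₀` with entries in `[-D₁, D₁]`. Then `f` vanishes on `H₀ · c(s)` for every `s`,
`c(s) = (s^{w_j})_j`. [folklore] -/
theorem evalAt_mul_curvePt_eq_zero (H₀ : Subgroup (GaGm n)) (hirr : IsIrred (H₀ : Set (GaGm n)))
    {D₀ D₁ : ℕ} {f : MvPolynomial (Fin (n + 1)) ℂ} (hfB : f ∈ Box (n := n) D₀ D₁ 1)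
    (hf : f ∈ vanishing (H₀ : Set (GaGm n))) {w : Fin n → ℤ}
    (hw : ∀ lam ∈ charGroup (H₀ : Set (GaGm n)), (∀ h, |lam h| ≤ D₁) → ∑ j, lam j * w j = 0)
    {k : GaGm n} (hk : k ∈ H₀) (s : ℂˣ) : evalAt f (k * curvePt w s) = 0 := by
  classical
  set Φ : (Fin (n + 1) →₀ ℕ) → (↥H₀ →* ℂ) := monChar H₀ with hΦ
  have hmem := mem_iff_of_isIrred H₀ hirr
  set ap := (toConnAlgSubgroup H₀ hirr).addPart with hap
  -- torus exponents of `f` are `≤ D₁`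
  have hbox : ∀ e ∈ f.support, ∀ h : Fin n, e h.succ ≤ D₁ := by
    intro e he h
    have := (mem_Box_iff.mp hfB).2 h
    rw [one_mul] at this
    exact (monomial_le_degreeOf h.succ he).trans this
  -- Step 1: the partial sums over `{e ; e 0 = i}` vanish identically on `H₀`
  have hstep1 : ∀ i : ℕ, (ap = true ∨ i = 0) →
      ∀ k' : ↥H₀, ∑ e ∈ f.support.filter (fun e => e 0 = i), f.coeff e * Φ e k' = 0 := by
    intro i hi k'
    have hk'mem := (hmem k').mp k'.2
    cases hadd : ap with
    | true =>
      -- all `(x, k'.2)` lie in `H₀`: a polynomial identity in `x`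
      have hx : ∀ x : ℂ, (Multiplicative.ofAdd x, (k' : GaGm n).2) ∈ H₀ := by
        intro x
        rw [hmem]
        exact ⟨fun h => Bool.noConfusion (hadd.symm.trans h), hk'mem.2⟩
      set p : Polynomial ℂ := ∑ e ∈ f.support,
        Polynomial.C (f.coeff e * charVal (k' : GaGm n).2 e) * Polynomial.X ^ (e 0) with hp
      have hpev : ∀ x : ℂ, p.eval x = evalAt f (Multiplicative.ofAdd x, (k' : GaGm n).2) := by
        intro x
        rw [hp, Polynomial.eval_finsetSum, evalAt_eq_sum]
        refine Finset.sum_congr rfl fun e _ => ?_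
        rw [Polynomial.eval_mul, Polynomial.eval_C, Polynomial.eval_pow, Polynomial.eval_X, toAdd_ofAdd]
        ring
      have hp0 : p = 0 := by
        refine Polynomial.eq_zero_of_infinite_isRoot p ?_
        have : {x : ℂ | p.IsRoot x} = Set.univ := by
          ext x
          simp only [Set.mem_setOf_eq, Set.mem_univ, iff_true, Polynomial.IsRoot.def, hpev]
          exact hf _ (hx x)
        rw [this]; exact Set.infinite_univ
      have hcoeff : p.coeff i = ∑ e ∈ f.support.filter (fun e => e 0 = i), f.coeff e * Φ e k' := by
        rw [hp, Polynomial.finsetSum_coeff, Finset.sum_filter]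
        refine Finset.sum_congr rfl fun e _ => ?_
        rw [Polynomial.coeff_C_mul_X_pow, hΦ, monChar_apply]
        by_cases h : e 0 = i
        · rw [if_pos h.symm, if_pos h]
        · rw [if_neg (Ne.symm h), if_neg h]
      rw [← hcoeff, hp0, Polynomial.coeff_zero]
    | false =>
      have hi0 : i = 0 := hi.resolve_left (fun h => Bool.noConfusion (hadd.symm.trans h))
      subst hi0
      have hk1 : Multiplicative.toAdd (k' : GaGm n).1 = 0 := by rw [hk'mem.1 hadd]; rfl
      have h0 := hf (k' : GaGm n) k'.2
      rw [evalAt_eq_sum] at h0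
      rw [← h0, Finset.sum_filter]
      refine Finset.sum_congr rfl fun e _ => ?_
      split_ifs with he0
      · rw [hΦ, monChar_apply, hk1, he0, pow_zero, one_mul]
      · rw [hk1, zero_pow he0, zero_mul, mul_zero]
  -- Step 2 (Artin): the class sums vanish
  have hstep2 : ∀ i : ℕ, (ap = true ∨ i = 0) → ∀ e₀ ∈ f.support, e₀ 0 = i →
      ∑ e ∈ (f.support.filter (fun e => e 0 = i)).filter (fun e => Φ e = Φ e₀), f.coeff e = 0 := by
    intro i hi e₀ he₀ he₀i
    set Si := f.support.filter (fun e => e 0 = i) with hSi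
    set T := Si.image Φ with hT
    set a : (↥H₀ →* ℂ) → ℂ := fun φ => ∑ e ∈ Si.filter (fun e => Φ e = φ), f.coeff e with ha
    have hmaps : ∀ e ∈ Si, Φ e ∈ T := fun e he => Finset.mem_image_of_mem _ he
    have hsum : ∑ φ ∈ T, a φ • (fun g : ↥H₀ →* ℂ => (g : ↥H₀ → ℂ)) φ = 0 := by
      funext k'
      rw [Finset.sum_apply, Pi.zero_apply]
      simp only [Pi.smul_apply, smul_eq_mul]
      have : ∑ φ ∈ T, a φ * φ k' = ∑ e ∈ Si, f.coeff e * Φ e k' := by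
        rw [← Finset.sum_fiberwise_of_maps_to hmaps (fun e => f.coeff e * Φ e k')]
        refine Finset.sum_congr rfl fun φ _ => ?_
        rw [ha, Finset.sum_mul]
        refine Finset.sum_congr rfl fun e he => ?_
        rw [(Finset.mem_filter.mp he).2]
      rw [this, hSi, hstep1 i hi k']
    have hli := linearIndependent_monoidHom (↥H₀) ℂ
    have ha0 : ∀ φ ∈ T, a φ = 0 := fun φ hφ => linearIndependent_iff'.mp hli T a hsum φ hφ
    have he₀S : e₀ ∈ Si := by rw [hSi, Finset.mem_filter]; exact ⟨he₀, he₀i⟩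
    have := ha0 (Φ e₀) (hmaps e₀ he₀S)
    rw [ha] at this
    exact this
  -- Step 3: expand along the curve and group by (`X`-exponent, character)
  rw [evalAt_mul_curvePt]
  set key : (Fin (n + 1) →₀ ℕ) → ℕ × (↥H₀ →* ℂ) := fun e => (e 0, Φ e) with hkey
  set T' := f.support.image key with hT'
  have hmaps' : ∀ e ∈ f.support, key e ∈ T' := fun e he => Finset.mem_image_of_mem _ he
  rw [← Finset.sum_fiberwise_of_maps_to hmaps']
  refine Finset.sum_eq_zero fun ψ hψ => ?_
  rw [hT', Finset.mem_image] at hψ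
  obtain ⟨e₀, he₀, rfl⟩ := hψ
  -- inside the class of `e₀` the values on `H₀` and the weights agree with those of `e₀`
  have hclass : ∀ e ∈ f.support.filter (fun e => key e = key e₀),
      f.coeff e * ((Multiplicative.toAdd k.1) ^ e 0 * (charVal k.2 e * ((s ^ wt w e : ℂˣ) : ℂ))) =
        f.coeff e * ((Multiplicative.toAdd k.1) ^ e₀ 0 * (charVal k.2 e₀ * ((s ^ wt w e₀ : ℂˣ) : ℂ))) := by
    intro e he
    rw [Finset.mem_filter] at he
    obtain ⟨he, hke⟩ := he
    have hk0 : e 0 = e₀ 0 := congrArg Prod.fst hke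
    have hΦe : Φ e = Φ e₀ := congrArg Prod.snd hke
    -- same character value at `k`
    have hval : charVal k.2 e = charVal k.2 e₀ := by
      have := congrArg (fun φ : ↥H₀ →* ℂ => φ ⟨k, hk⟩) hΦe
      simpa only [hΦ, monChar_apply] using this
    -- same weight: the difference of exponents is a small character of `H₀`
    have hwt : wt w e = wt w e₀ := by
      have hd := sub_mem_charGroup_of_monChar_eq (K := H₀) hΦe
      have hbd : ∀ h : Fin n, |((e₀ h.succ : ℤ) - e h.succ)| ≤ D₁ := by
        intro h
        have h1 := hbox e he h
        have h2 := hbox e₀ he₀ h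
        rw [abs_sub_le_iff]
        constructor <;> omega
      have h0 := hw _ hd hbd
      have : wt w e₀ - wt w e = ∑ j, ((e₀ j.succ : ℤ) - e j.succ) * w j := by
        rw [wt, wt, ← Finset.sum_sub_distrib]
        refine Finset.sum_congr rfl fun j _ => ?_
        ring
      rw [h0] at this
      omega
    rw [hk0, hval, hwt]
  rw [Finset.sum_congr rfl hclass, ← Finset.sum_mul]
  -- the class of `e₀` is the fibre used in Step 2
  have hfib : f.support.filter (fun e => key e = key e₀) =
      (f.support.filter (fun e => e 0 = e₀ 0)).filter (fun e => Φ e = Φ e₀) := by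
    rw [Finset.filter_filter]
    refine Finset.filter_congr fun e _ => ?_
    rw [hkey]
    exact Prod.mk.injEq _ _ _ _ |>.to_iff
  rw [hfib]
  by_cases hcase : ap = true ∨ e₀ 0 = 0
  · rw [hstep2 (e₀ 0) hcase e₀ he₀ rfl, zero_mul]
  · rw [not_or] at hcase
    have hfalse : ap = false := by
      cases h : ap with
      | true => exact absurd h hcase.1
      | false => rfl
    have hk1 : Multiplicative.toAdd k.1 = 0 := by rw [((hmem k).mp hk).1 hfalse]; rfl
    rw [hk1, zero_pow hcase.2, zero_mul, mul_zero]

end DegreeClause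

/-! ### The degree clause -/

/-- **Degree clause (Philippon 1986, Thm 2.1 / Déf. 3.5, reading (iii) of
`Philippon1986_GaGm_P1n`).** If an irreducible closed subgroup `H₀ ≤ G(ℂ) = ℂ × (ℂˣ)ⁿ` is a
component of the zero set of a family of box polynomials `F ⊆ Box(D₀, D₁; 1)` (all partial
`Y`-degrees `≤ D₁`), then the lattice `charGroup H₀` of characters trivial on `H₀` is rationally
spanned by its elements `λ` with `max_h |λ_h| ≤ D₁`: there is a finite `Λ ⊆ charGroup H₀` of such
characters such that every `χ ∈ charGroup H₀` has a non-zero multiple in `⟨Λ⟩`.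
[cite: Philippon1986, Thm 2.1 with Déf. 3.5 (p. 371), case G = 𝔾ₐ × 𝔾ₘⁿ ⊂ (ℙ¹)ⁿ⁺¹, cᵢ = 1] -/
theorem exists_box_chars_of_mem_comps {D₀ D₁ : ℕ} {F : Set (MvPolynomial (Fin (n + 1)) ℂ)}
    (hF : F ⊆ Box (n := n) D₀ D₁ 1) (H₀ : Subgroup (GaGm n)) (hirr : IsIrred (H₀ : Set (GaGm n)))
    {𝔮 : Ideal (MvPolynomial (Fin (n + 1)) ℂ)} (h𝔮 : 𝔮 ∈ comps (zeroSet (n := n) F))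
    (hH : (H₀ : Set (GaGm n)) = zeroSetI (n := n) 𝔮) :
    ∃ Λ : Finset (Fin n → ℤ), (↑Λ : Set (Fin n → ℤ)) ⊆ charGroup (H₀ : Set (GaGm n)) ∧
      (∀ lam ∈ Λ, ∀ h, |lam h| ≤ D₁) ∧
      ∀ χ ∈ charGroup (H₀ : Set (GaGm n)), ∃ k : ℤ, k ≠ 0 ∧
        k • χ ∈ AddSubgroup.closure (↑Λ : Set (Fin n → ℤ)) := by
  classical
  have hfin : {lam : Fin n → ℤ | lam ∈ charGroup (H₀ : Set (GaGm n)) ∧ ∀ h, |lam h| ≤ D₁}.Finite := by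
    refine (Set.Finite.pi (t := fun _ : Fin n => Set.Icc (-(D₁ : ℤ)) D₁)
      fun _ => Set.finite_Icc _ _).subset ?_
    rintro lam ⟨-, hlam⟩
    exact Set.mem_univ_pi.mpr fun h => abs_le.mp (hlam h)
  have hΛmem : ∀ lam, lam ∈ hfin.toFinset ↔ lam ∈ charGroup (H₀ : Set (GaGm n)) ∧ ∀ h, |lam h| ≤ D₁ :=
    fun lam => by rw [Set.Finite.mem_toFinset]; rfl
  refine ⟨hfin.toFinset, fun lam hlam => ((hΛmem lam).mp hlam).1,
    fun lam hlam => ((hΛmem lam).mp hlam).2, ?_⟩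
  intro χ₀ hχ₀
  by_contra hcon
  push Not at hcon
  obtain ⟨w, hwΛ, hwχ⟩ := DegreeClause.exists_int_functional _ χ₀ hcon
  have hw : ∀ lam ∈ charGroup (H₀ : Set (GaGm n)), (∀ h, |lam h| ≤ D₁) → ∑ j, lam j * w j = 0 :=
    fun lam hlam hb => hwΛ lam (by rw [Finset.mem_coe, hΛmem]; exact ⟨hlam, hb⟩)
  -- data of the component
  have h𝔮m : 𝔮 ∈ (vanishing (zeroSet (n := n) F)).minimalPrimes := mem_comps.mp h𝔮
  have hvan : vanishing (H₀ : Set (GaGm n)) = 𝔮 := by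
    rw [hH]; exact (isIrred_zeroSet_of_mem_minimalPrimes h𝔮m).2.1
  have hFq : ∀ f ∈ F, f ∈ vanishing (H₀ : Set (GaGm n)) := fun f hf => by
    rw [hvan]; exact h𝔮m.1.2 (subset_vanishing_zeroSet F hf)
  -- the swept set `K = H₀ · c(ℂˣ)` lies in `Z(F)`
  have hKF : DegreeClause.curveSet w (H₀ : Set (GaGm n)) ⊆ zeroSet (n := n) F := by
    rintro g ⟨k, hk, s, rfl⟩ f hf
    exact DegreeClause.evalAt_mul_curvePt_eq_zero H₀ hirr (hF hf) (hFq f hf) hw hk s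
  -- its closure `Kc` is an irreducible closed subset of `Z(F)` containing `H₀`
  have hKcirr : IsIrred (zeroSet (n := n)
      (↑(vanishing (DegreeClause.curveSet w (H₀ : Set (GaGm n)))) : Set (MvPolynomial (Fin (n + 1)) ℂ))) := by
    refine ⟨isClosedG_zeroSet _, ?_⟩
    rw [vanishing_zeroSet_vanishing]
    exact DegreeClause.isPrime_vanishing_curveSet w ⟨1, H₀.one_mem⟩ (by rw [hvan]; exact h𝔮m.1.1)
  have hKcF : zeroSet (n := n)
      (↑(vanishing (DegreeClause.curveSet w (H₀ : Set (GaGm n)))) : Set (MvPolynomial (Fin (n + 1)) ℂ)) ⊆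
      zeroSet (n := n) F := by
    rw [← zeroSet_vanishing_zeroSet F]
    exact zeroSet_antitone (vanishing_antitone hKF)
  have hKKc := subset_zeroSet_vanishing (DegreeClause.curveSet w (H₀ : Set (GaGm n)))
  have hHK : (H₀ : Set (GaGm n)) ⊆ DegreeClause.curveSet w (H₀ : Set (GaGm n)) :=
    fun k hk => ⟨k, hk, 1, by rw [DegreeClause.curvePt_one, mul_one]⟩
  obtain ⟨𝔮', h𝔮'm, hKc𝔮'⟩ := hKcirr.exists_minimalPrimes_subset hKcF
  have hsub : zeroSetI (n := n) 𝔮 ⊆ zeroSet ↑𝔮' := by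
    rw [← hH]; exact hHK.trans (hKKc.trans hKc𝔮')
  have heq : 𝔮 = 𝔮' := eq_of_zeroSet_subset_of_mem_minimalPrimes h𝔮m h𝔮'm hsub
  -- the point `c(2)` lies in `K ⊆ Kc ⊆ Z(𝔮') = Z(𝔮) = H₀`, contradicting `⟨χ₀, w⟩ ≠ 0`
  have hcK : DegreeClause.curvePt w (Units.mk0 (2 : ℂ) two_ne_zero) ∈
      DegreeClause.curveSet w (H₀ : Set (GaGm n)) := ⟨1, H₀.one_mem, _, one_mul _⟩
  have hcH : DegreeClause.curvePt w (Units.mk0 (2 : ℂ) two_ne_zero) ∈ (H₀ : Set (GaGm n)) := by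
    rw [hH]
    have := hKc𝔮' (hKKc hcK)
    rwa [← heq] at this
  have h1 := hχ₀ _ hcH
  simp only [DegreeClause.curvePt_snd] at h1
  have hz : ∀ (t : Finset (Fin n)) (f : Fin n → ℤ),
      ∏ j ∈ t, (Units.mk0 (2 : ℂ) two_ne_zero) ^ f j = (Units.mk0 (2 : ℂ) two_ne_zero) ^ ∑ j ∈ t, f j := by
    intro t f
    induction t using Finset.induction_on with
    | empty => simp
    | insert i t hi ih => rw [Finset.prod_insert hi, Finset.sum_insert hi, ih, zpow_add]
  have h2 : (Units.mk0 (2 : ℂ) two_ne_zero) ^ (∑ j, χ₀ j * w j) = 1 := by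
    rw [← h1, ← hz]
    refine Finset.prod_congr rfl fun j _ => ?_
    rw [← zpow_mul, mul_comm]
  have h3 : (2 : ℝ) ^ (∑ j, χ₀ j * w j) = 1 := by
    have := congrArg (fun u : ℂˣ => ‖(u : ℂ)‖) h2
    simpa [norm_zpow] using this
  exact hwχ ((zpow_eq_one_iff_right₀ (by norm_num) (by norm_num)).mp h3)

end GaGm

end Literature.NumberTheory.Transcendental
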